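import Summits.Ventures.PercRepro.CrossTermPlus
import Summits.Ventures.PercRepro.C011Induction
import Summits.Ventures.PercRepro.TypeIdentityHolds

/-!
# PercRepro — Lemma 5 along a SECOND edge: the level-1 cross term and the reduction
`Lemma 5 ⟸ «B(e) ≥ 0 for every free edge e ≠ g»` (p6, gen 4)

`LEAD-C011-concavity.md` §10.6 (INBOX lead 05:12:46Z, «LEMMA 5 IS ONE TWO-GRAPH INEQUALITY»):
the concavity slack `Q⁺(Δ_g, Δ_g)` of `Φ⁺` along `g` is itself a quadratic in every OTHER weight
`p_e`, `e ≠ g`, because `Δ_g` is affine in `p_e`: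
`Q⁺(Δ_g, Δ_g)(p[e := t]) = (1 − t)² Q⁺(Δ_g, Δ_g)(p[e := 0]) + 2t(1 − t) · Q⁺(Δ_g(p[e := 0]), Δ_g(p[e := 1])) + t² Q⁺(Δ_g, Δ_g)(p[e := 1])`.
The middle coefficient is the LEVEL-1 CROSS TERM of the two minors `G − e` and `G / e`
(`crossTwo`; the lead's `B(e)` is `−crossTwo`).  The base case of the free-edge induction is
`Q⁺(Δ_g, Δ_g) = 0` for deterministic weights (every monomial of the 6-mark form pairs two DIFFERENT
types, `TypeIdentity_holds` + the pairwise disjointness of the type events), so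

* **`EdgeQuadNonpos_of_CrossTwoNonpos`**: if `crossTwo ≤ 0` on every (multigraph, weights, marks,
  `g`, `e ≠ g`), then `Q⁺(Δ_g, Δ_g) ≤ 0` everywhere — the concavity lemma (`EdgeQuadNonpos`), hence
  `C011`/`C005` through typer-2's chain — but the hypothesis `CrossTwoNonpos` is FALSE (below);
* **`EdgeQuadNonpos_of_CrossTwoDisc`**: the same from the DISCRIMINANT condition
  `crossTwo ≤ 0 ∨ crossTwo² ≤ Q⁺(Δ_g,Δ_g)(p[e:=0]) · Q⁺(Δ_g,Δ_g)(p[e:=1])` (the two-sector AM-GM);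
  and conversely **`CrossTwoDisc_of_EdgeQuadNonpos`** (p2 06:59Z: the condition is the concavity lemma
  on the segment `p[e := t]`), so **`EdgeQuadNonpos_iff_CrossTwoDisc`** — the discriminant form is a
  REFORMULATION of Lemma 5, not a weaker hypothesis.

`CrossTwoNonpos` (the lead's «`B(e) ≥ 0` for every second edge», §10.6) is FALSE: on the gadget
graph the level-1 cross term `B(e) = −crossTwo` is negative along each of the three edges
`v–m₂`, `a–H`, `v–H` at extreme palettes, e.g. `B(v–m₂) = −12369/32000000000` at
`(a–m₁, a–H, v–H, H–m₁, H–m₄, m₁–m₂) = (.9, .95, .3, .5, .1, .9)` (exact rationals, p6 gen 4,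
`mining/p6/attach/crosscheck2.out`), while the discriminant condition holds there by two orders
of magnitude. Nothing here proves `CrossTwoDisc`; this file records the reductions in the kernel.
-/

namespace PercRepro

open Finset

namespace MultiGraph

variable {V E : Type*} (G : MultiGraph V E) [Fintype E] [DecidableEq E]

/-- **`Δ_g`**: the difference of the laws with `g` open and closed (`π¹_g − π⁰_g`). -/
noncomputable def deltaVec (p : E → ℝ) (g : E) (a b c d : V) : Fin 15 → ℝ := fun s =>
  G.law4 (Function.update p g 1) a b c d s - G.law4 (Function.update p g 0) a b c d s

/-- `Q⁺(Δ_g, Δ_g)` is the quadratic form of `Q⁺` at `Δ_g`. -/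
theorem deltaQuad_eq_quadPlus_deltaVec (p : E → ℝ) (g : E) (a b c d : V) :
    G.deltaQuad p g a b c d = quadPlus (G.deltaVec p g a b c d) (G.deltaVec p g a b c d) :=
  rfl

/-- `Δ_g` does not depend on the weight of `g` itself. -/
theorem deltaVec_update_self (p : E → ℝ) (g : E) (x : ℝ) (a b c d : V) :
    G.deltaVec (Function.update p g x) g a b c d = G.deltaVec p g a b c d := by
  funext s
  simp only [deltaVec, Function.update_idem]

/-- `Q⁺(Δ_g, Δ_g)` does not depend on the weight of `g` itself. -/
theorem deltaQuad_update_self (p : E → ℝ) (g : E) (x : ℝ) (a b c d : V) :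
    G.deltaQuad (Function.update p g x) g a b c d = G.deltaQuad p g a b c d := by
  rw [deltaQuad_eq_quadPlus_deltaVec, deltaVec_update_self, deltaQuad_eq_quadPlus_deltaVec]

/-- **`Δ_g` is affine in every other weight**: for `e ≠ g`,
`Δ_g(p[e := t]) = (1 − t) Δ_g(p[e := 0]) + t Δ_g(p[e := 1])`. -/
theorem deltaVec_update_eq (p : E → ℝ) {g e : E} (he : e ≠ g) (t : ℝ) (a b c d : V) :
    G.deltaVec (Function.update p e t) g a b c d = fun s =>
      (1 - t) * G.deltaVec (Function.update p e 0) g a b c d s +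
        t * G.deltaVec (Function.update p e 1) g a b c d s := by
  funext s
  simp only [deltaVec]
  rw [Function.update_comm he t (1 : ℝ) p, Function.update_comm he t (0 : ℝ) p,
    G.law4_update_eq (Function.update p g 1) e t a b c d,
    G.law4_update_eq (Function.update p g 0) e t a b c d,
    Function.update_comm (Ne.symm he) (1 : ℝ) (0 : ℝ) p,
    Function.update_comm (Ne.symm he) (1 : ℝ) (1 : ℝ) p,
    Function.update_comm (Ne.symm he) (0 : ℝ) (0 : ℝ) p,
    Function.update_comm (Ne.symm he) (0 : ℝ) (1 : ℝ) p]
  ring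

/-- **The level-1 cross term** of the two minors `G − e` (`p[e := 0]`) and `G / e` (`p[e := 1]`)
along `g`: `Q⁺(Δ_g(p[e := 0]), Δ_g(p[e := 1]))`.  The lead's `B(e)` (§10.6) is `−crossTwo`. -/
noncomputable def crossTwo (p : E → ℝ) (g e : E) (a b c d : V) : ℝ :=
  quadPlus (G.deltaVec (Function.update p e 0) g a b c d)
    (G.deltaVec (Function.update p e 1) g a b c d)

/-- **The Bernstein expansion of the slack along a second edge** (`e ≠ g`):
`Q⁺(Δ_g,Δ_g)(p[e := t]) = (1 − t)² Q⁺(Δ_g,Δ_g)(p[e := 0]) + 2t(1 − t) crossTwo + t² Q⁺(Δ_g,Δ_g)(p[e := 1])`. -/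
theorem deltaQuad_update_bernstein (p : E → ℝ) {g e : E} (he : e ≠ g) (t : ℝ) (a b c d : V) :
    G.deltaQuad (Function.update p e t) g a b c d =
      (1 - t) ^ 2 * G.deltaQuad (Function.update p e 0) g a b c d +
        2 * t * (1 - t) * G.crossTwo p g e a b c d +
        t ^ 2 * G.deltaQuad (Function.update p e 1) g a b c d := by
  rw [deltaQuad_eq_quadPlus_deltaVec, deltaVec_update_eq G p he t, quadPlus_segment,
    ← deltaQuad_eq_quadPlus_deltaVec, ← deltaQuad_eq_quadPlus_deltaVec, crossTwo]

/-- The two-sector bound: `(1 − t)² A + t² B ≥ 2t(1 − t) C` for `t ∈ [0, 1]`, `A, B ≥ 0` and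
`C ≤ 0 ∨ C² ≤ A B`. -/
theorem two_sector_nonneg {A B C t : ℝ} (hA : 0 ≤ A) (hB : 0 ≤ B) (ht0 : 0 ≤ t) (ht1 : t ≤ 1)
    (hC : C ≤ 0 ∨ C ^ 2 ≤ A * B) :
    0 ≤ (1 - t) ^ 2 * A - 2 * t * (1 - t) * C + t ^ 2 * B := by
  have hs : 0 ≤ t * (1 - t) := mul_nonneg ht0 (by linarith)
  rcases hC with hC | hC
  · nlinarith [mul_nonneg (sq_nonneg (1 - t)) hA, mul_nonneg (sq_nonneg t) hB,
      mul_nonneg hs (neg_nonneg.mpr hC)]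
  · -- `2t(1−t)C ≤ 2t(1−t)|C|` and `(2t(1−t)|C|)² ≤ 4t²(1−t)²AB ≤ ((1−t)²A + t²B)²`
    have hX : 0 ≤ (1 - t) ^ 2 * A := mul_nonneg (sq_nonneg _) hA
    have hY : 0 ≤ t ^ 2 * B := mul_nonneg (sq_nonneg _) hB
    have key : (2 * t * (1 - t) * C) ^ 2 ≤ ((1 - t) ^ 2 * A + t ^ 2 * B) ^ 2 := by
      have h1 : (2 * t * (1 - t) * C) ^ 2 = 4 * (t * (1 - t)) ^ 2 * C ^ 2 := by ring
      have h2 : 4 * (t * (1 - t)) ^ 2 * C ^ 2 ≤ 4 * (t * (1 - t)) ^ 2 * (A * B) :=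
        mul_le_mul_of_nonneg_left hC (by positivity)
      have h3 : 4 * (t * (1 - t)) ^ 2 * (A * B) ≤ ((1 - t) ^ 2 * A + t ^ 2 * B) ^ 2 := by
        nlinarith [sq_nonneg ((1 - t) ^ 2 * A - t ^ 2 * B)]
      linarith
    have hle : 2 * t * (1 - t) * C ≤ (1 - t) ^ 2 * A + t ^ 2 * B :=
      abs_le_of_sq_le_sq' key (by linarith) |>.2
    linarith

/-- **Two minors and a cross term give the edge**: if `Q⁺(Δ_g,Δ_g) ≤ 0` at `p[e := 0]` and at
`p[e := 1]` and the level-1 cross term satisfies the discriminant condition, then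
`Q⁺(Δ_g,Δ_g) ≤ 0` at `p[e := t]` for every `t ∈ [0, 1]`. -/
theorem deltaQuad_update_nonpos (p : E → ℝ) {g e : E} (he : e ≠ g) {t : ℝ} (ht0 : 0 ≤ t)
    (ht1 : t ≤ 1) (a b c d : V) (h0 : G.deltaQuad (Function.update p e 0) g a b c d ≤ 0)
    (h1 : G.deltaQuad (Function.update p e 1) g a b c d ≤ 0)
    (hc : G.crossTwo p g e a b c d ≤ 0 ∨ (G.crossTwo p g e a b c d) ^ 2 ≤
      G.deltaQuad (Function.update p e 0) g a b c d * G.deltaQuad (Function.update p e 1) g a b c d) :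
    G.deltaQuad (Function.update p e t) g a b c d ≤ 0 := by
  rw [G.deltaQuad_update_bernstein p he t a b c d]
  have := two_sector_nonneg (A := -G.deltaQuad (Function.update p e 0) g a b c d)
    (B := -G.deltaQuad (Function.update p e 1) g a b c d) (C := G.crossTwo p g e a b c d)
    (t := t) (by linarith) (by linarith) ht0 ht1 (by
      rcases hc with hc | hc
      · exact Or.inl hc
      · right; linarith)
  linarith

/-! ### The base case: deterministic weights have `Q⁺(Δ_g, Δ_g) = 0` -/

/-- Under a point mass two disjoint events cannot both have positive probability. -/
theorem prob_detWeights_mul_eq_zero {σ : Config E} {X Y : Set (Config E)}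
    (h : Disjoint X Y) : prob (detWeights σ) X * prob (detWeights σ) Y = 0 := by
  by_cases hX : σ ∈ X
  · have hY : σ ∉ Y := Set.disjoint_left.mp h hX
    rw [prob_detWeights_of_notMem hY, mul_zero]
  · rw [prob_detWeights_of_notMem hX, zero_mul]

/-- The 6-mark left side vanishes at a point mass (every monomial pairs two different types). -/
theorem sixMarkLHS_detWeights (σ : Config E) (g : E) (a b c d : V) :
    G.sixMarkLHS (detWeights σ) g a b c d = 0 := by
  have hcl := G.mergeClassification g a b c d
  unfold sixMarkLHS
  have h1 : ∀ i j : Fin 3, (if i ≠ j then prob (detWeights σ) (G.typeB g a b c d i) *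
      prob (detWeights σ) (G.typeB g a b c d j) else 0) = 0 := by
    intro i j
    split_ifs with hij
    · exact prob_detWeights_mul_eq_zero (hcl.disjBB i j hij)
    · rfl
  have h2 : ∀ i j : Fin 3, (if i ≠ j then prob (detWeights σ) (G.typeB g a b c d i) *
      prob (detWeights σ) (G.typeC g a b c d j) else 0) = 0 := by
    intro i j
    split_ifs with hij
    · exact prob_detWeights_mul_eq_zero (hcl.disjBC i j)
    · rfl
  simp only [h1, h2, Finset.sum_const_zero, mul_zero, add_zero]

/-- The 6-mark right side vanishes at a point mass. -/
theorem sixMarkRHS_detWeights (σ : Config E) (g : E) (a b c d : V) :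
    G.sixMarkRHS (detWeights σ) g a b c d = 0 := by
  have hcl := G.mergeClassification g a b c d
  unfold sixMarkRHS
  have h1 : ∀ i j : Fin 3, (if i ≠ j then prob (detWeights σ) (G.typeA g a b c d i) *
      prob (detWeights σ) (G.typeB g a b c d j) else 0) = 0 := by
    intro i j
    split_ifs with hij
    · exact prob_detWeights_mul_eq_zero (hcl.disjAB i j)
    · rfl
  have h2 : ∀ i : Fin 3, prob (detWeights σ) (G.typeA g a b c d i) *
      prob (detWeights σ) (G.typeD g a b c d i) = 0 :=
    fun i => prob_detWeights_mul_eq_zero (hcl.disjAD i i)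
  have h3 : (∑ i : Fin 3, prob (detWeights σ) (G.typeA g a b c d i)) *
      prob (detWeights σ) (G.typeE g a b c d) = 0 := by
    rw [Finset.sum_mul]
    exact Finset.sum_eq_zero fun i _ => prob_detWeights_mul_eq_zero (hcl.disjAE i)
  have h4 : ∀ i j : Fin 3, (if i ≠ j then prob (detWeights σ) (G.typeC g a b c d i) *
      prob (detWeights σ) (G.typeD g a b c d j) else 0) = 0 := by
    intro i j
    split_ifs with hij
    · exact prob_detWeights_mul_eq_zero (hcl.disjCD i j)
    · rfl
  have h5 : ∀ i j : Fin 3, (if i ≠ j then prob (detWeights σ) (G.typeD g a b c d i) *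
      prob (detWeights σ) (G.typeD g a b c d j) else 0) = 0 := by
    intro i j
    split_ifs with hij
    · exact prob_detWeights_mul_eq_zero (hcl.disjDD i j hij)
    · rfl
  simp only [h1, h2, h3, h4, h5, Finset.sum_const_zero, mul_zero, add_zero]

end MultiGraph

namespace MultiGraph

-- `TypeIdentity` is stated over `Type`, so the base case is too.
variable {V E : Type} (G : MultiGraph V E) [Fintype E] [DecidableEq E]

/-- **Base case**: at deterministic weights `Q⁺(Δ_g, Δ_g) = 0` (the point mass sits in one type;
every monomial of the 6-mark form pairs two different types). -/
theorem deltaQuad_detWeights (σ : Config E) (g : E) (a b c d : V) :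
    G.deltaQuad (detWeights σ) g a b c d = 0 := by
  rw [TypeIdentity_holds G (detWeights σ) (isProb_detWeights σ) a b c d g,
    sixMarkLHS_detWeights, sixMarkRHS_detWeights, sub_zero]

end MultiGraph

/-! ### The named hypotheses and the reduction -/

/-- **The level-1 cross term is nonpositive** (the lead's «`B(e) ≥ 0` for every free edge
`e ≠ g`», §10.6): `Q⁺(Δ_g(p[e := 0]), Δ_g(p[e := 1])) ≤ 0` for every multigraph, weights, marks,
edge `g` and edge `e ≠ g`.  **FALSE** (p6 gen 4: negative on the gadget along `v–m₂`, `a–H`, `v–H`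
at extreme palettes, exact rationals); kept as the shape of the whole-form single-edge induction. -/
def CrossTwoNonpos : Prop :=
  ∀ {V E : Type} [Fintype E] [DecidableEq E] (G : MultiGraph V E) (p : E → ℝ), IsProb p →
    ∀ (a b c d : V) (g e : E), e ≠ g → G.crossTwo p g e a b c d ≤ 0

/-- **The discriminant form**: along every `e ≠ g` either the cross term is `≤ 0` or its square is
at most the product of the two end slacks (the two-sector AM-GM); weaker than `CrossTwoNonpos`,
and the LIVE hypothesis (it holds on the gadget where `CrossTwoNonpos` fails).  OPEN. -/
def CrossTwoDisc : Prop :=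
  ∀ {V E : Type} [Fintype E] [DecidableEq E] (G : MultiGraph V E) (p : E → ℝ), IsProb p →
    ∀ (a b c d : V) (g e : E), e ≠ g →
      G.crossTwo p g e a b c d ≤ 0 ∨ (G.crossTwo p g e a b c d) ^ 2 ≤
        G.deltaQuad (Function.update p e 0) g a b c d *
          G.deltaQuad (Function.update p e 1) g a b c d

/-- The nonpositive form implies the discriminant form. -/
theorem CrossTwoDisc_of_CrossTwoNonpos (h : CrossTwoNonpos) : CrossTwoDisc :=
  fun G p hp a b c d g e he => Or.inl (h G p hp a b c d g e he)

/-- **Lemma 5 from the discriminant condition on the level-1 cross term**, by free-edge induction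
(`induction_free`): deterministic weights give `0`, and un-fixing an edge `e ≠ g` is the
Bernstein expansion `deltaQuad_update_bernstein` with the two-sector bound; un-fixing `g` itself
changes nothing (`deltaQuad_update_self`). -/
theorem EdgeQuadNonpos_of_CrossTwoDisc (h : CrossTwoDisc) : EdgeQuadNonpos := by
  intro V E _ _ G p hp a b c d g
  refine induction_free (P := fun q => G.deltaQuad q g a b c d ≤ 0) ?_ ?_ hp
  · intro σ
    rw [G.deltaQuad_detWeights σ g a b c d]
  · intro q e hq h1 h0
    by_cases heg : e = g
    · subst heg
      rw [G.deltaQuad_update_self q e 1 a b c d] at h1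
      exact h1
    · have hqe : q = Function.update q e (q e) := (Function.update_eq_self e q).symm
      rw [hqe]
      exact G.deltaQuad_update_nonpos q heg (hq e).1 (hq e).2 a b c d h0 h1
        (h G q hq a b c d g e heg)

/-- **Lemma 5 (every edge, every marking) from `B(e) ≥ 0` for every second edge.** -/
theorem EdgeQuadNonpos_of_CrossTwoNonpos (h : CrossTwoNonpos) : EdgeQuadNonpos :=
  EdgeQuadNonpos_of_CrossTwoDisc (CrossTwoDisc_of_CrossTwoNonpos h)

/-- **The converse** (p2 06:59Z): the concavity lemma forces the discriminant condition along every
second edge — `Q⁺(Δ_g,Δ_g) ≤ 0` on the whole segment `p[e := t]` is exactly `D₀, D₁ ≤ 0` together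
with `C ≤ 0 ∨ C² ≤ D₀ D₁` (evaluate the quadratic at its vertex `t* = (D₀ − C)/(D₀ + D₁ − 2C)`). -/
theorem CrossTwoDisc_of_EdgeQuadNonpos (h : EdgeQuadNonpos) : CrossTwoDisc := by
  intro V E _ _ G p hp a b c d g e he
  by_cases hC : G.crossTwo p g e a b c d ≤ 0
  · exact Or.inl hC
  right
  have hC' : 0 < G.crossTwo p g e a b c d := lt_of_not_ge hC
  set C := G.crossTwo p g e a b c d with hCdef
  set D₀ := G.deltaQuad (Function.update p e 0) g a b c d with hD₀
  set D₁ := G.deltaQuad (Function.update p e 1) g a b c d with hD₁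
  have h0 : D₀ ≤ 0 := h G _ (hp.update e ⟨le_rfl, zero_le_one⟩) a b c d g
  have h1 : D₁ ≤ 0 := h G _ (hp.update e ⟨zero_le_one, le_rfl⟩) a b c d g
  have hA : D₀ + D₁ - 2 * C < 0 := by linarith
  -- the vertex `t* = (D₀ − C)/(D₀ + D₁ − 2C)` lies in `[0, 1]`
  set t := (D₀ - C) / (D₀ + D₁ - 2 * C) with ht
  have htA : t * (D₀ + D₁ - 2 * C) = D₀ - C := by
    rw [ht]
    exact div_mul_cancel₀ _ hA.ne
  have ht0 : 0 ≤ t := by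
    rw [ht]
    exact div_nonneg_of_nonpos (by linarith) hA.le
  have ht1 : t ≤ 1 := by
    rw [ht, div_le_one_of_neg hA]
    linarith
  have key := h G (Function.update p e t) (hp.update e ⟨ht0, ht1⟩) a b c d g
  rw [G.deltaQuad_update_bernstein p he t a b c d, ← hD₀, ← hD₁, ← hCdef] at key
  -- `f(t*) · A = D₀ D₁ − C²` with `A = D₀ + D₁ − 2C`
  have hprod : ((1 - t) ^ 2 * D₀ + 2 * t * (1 - t) * C + t ^ 2 * D₁) * (D₀ + D₁ - 2 * C) =
      D₀ * D₁ - C ^ 2 := by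
    linear_combination (t * (D₀ + D₁ - 2 * C) + (C - D₀)) * htA
  have : 0 ≤ D₀ * D₁ - C ^ 2 := by
    rw [← hprod]
    exact mul_nonneg_of_nonpos_of_nonpos key hA.le
  linarith

/-- **Lemma 5 ⟺ the discriminant condition along every second edge.** -/
theorem EdgeQuadNonpos_iff_CrossTwoDisc : EdgeQuadNonpos ↔ CrossTwoDisc :=
  ⟨CrossTwoDisc_of_EdgeQuadNonpos, EdgeQuadNonpos_of_CrossTwoDisc⟩

/-- **C-005⁺ from the level-1 cross term** (typer-2's `C011_of_PhiPlus_edge_concave`). -/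
theorem C011_of_CrossTwoNonpos (h : CrossTwoNonpos) : C011 :=
  C011_of_PhiPlus_edge_concave
    (PhiPlus_edge_concave_iff_EdgeQuadNonpos.mpr (EdgeQuadNonpos_of_CrossTwoNonpos h))

/-- **C-005 from the level-1 cross term.** -/
theorem C005_of_CrossTwoNonpos (h : CrossTwoNonpos) : C005 :=
  C005_of_C011 (C011_of_CrossTwoNonpos h)

end PercRepro
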